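import Literature.AnabelianGeometry.EtaleTheta.SettingModelTateSemidirect
import Literature.AnabelianGeometry.EtaleTheta.SettingModelChiGroupLevel
import Literature.AnabelianGeometry.EtaleTheta.SettingModelGfpSlim
import Literature.AnabelianGeometry.SemiGraphs.TemperedDeltaCompletion
import Literature.AnabelianGeometry.SemiGraphs.TemperedDecompositionCompact
import Literature.AnabelianGeometry.SemiGraphs.TemperedOpenMapping
import HarnessLib

/-!
# Root models of [EtTh] §1, R78 STAGE 2 («Tate shear», abc-iut-w5-d249's F4q `curveχq p i j`): the [SemiAnbd] §6 /
# Ex. 3.10 group-level package `GroupLevelData (curveχq p i j)` — UNCONDITIONAL, for every `(i, j)` (proof-only)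

Mochizuki, *Semi-graphs of anabelioids*, Publ. RIMS **42** (2006) [SemiAnbd], Ex. 3.10 pp. 43–45 («`π₁^temp(X_K)` is a
tempered topological group», «`Δ` is also tempered», «both `Δ` and `Π` are temp-slim»), §6 p. 69, p. 73
[cite: MochizukiSemiAnbd2006, Ex 3.10 p.45]; [IUTchI] Rmk. 2.5.3 (i) (T1) «Galois-countable»; [EtTh] §1 pp. 12–13
[cite: MochizukiEtTh2009, §1 p.13].  abc-iut cell, seat abc-iut-w5-d111 (gen 4); R78 cluster STAGE 2 (abc-iut-L6-d6's MAP
#5): the capstone agreed with the F4q author abc-iut-w5-d249 (08:48Z «YES please file the GroupLevelData capstone»).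
PROOF-ONLY (0 definitions), over `SettingModelTateSemidirect` (p433589: `PiTpχq p i j := Γ ⋊[actχq p i j] G_{ℚ_p}` with
the AFFINE action `σ ↦ Inn(b^{κ_p^i}) ∘ shear(κ_p^j) ∘ θ_χ`, topology induced along `(left, right)`, `curveχq p i j`,
and `isTempered_PiTpχq` = this seat's action-generic `isTempered_gfp_semidirect_of_action`, p432271), abc-iut-w5-d249's
generic `Semidirect.isSlimGroup_of` / `IsSlimGroup.of_continuousMulEquiv'` (SettingModelChiGroupLevel p431012) and this
seat's `isSlimGroup_gfp` / `secondCountableTopology_gfp` (SettingModelGfpSlim p431378):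

* `secondCountableTopology_PiTpχq` — `Π^tp_X` of the stage-2 model is Galois-countable;
* `isSlimGroup_PiTpχq`, `isSlimGroup_deltaTempχq` — `Π^tp_X` and `Δ^tp_X` are slim (Γ slim, `G_{ℚ_p}` slim, any action);
* `isTempered_deltaTemp_curveχq` — `Δ^tp_X` is tempered (closed subgroup of the tempered `Π^tp_X`);
* **`nonempty_groupLevelData_curveχq_holds : Nonempty (TemperedCurve.GroupLevelData (curveχq p i j))`** — abc-iut-L3's
  parameter bundle (ruling η′) inhabited with NO binder; `exists_toTemperedArithmeticGroup_curveχq_holds`;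
* η′-consequences: `isOpenMap_aug_curveχq'` (open mapping route; `= isOpenMap_augχq`), **`ker_augHat_eq_deltaHat_curveχq`**
  (exactness of `1 → Δ_X → Π_X → G_K`, (P1)), **`isProfiniteCompletion_deltaToHat_curveχq`** (`Δ_X = (Δ^tp_X)^∧`).
HONEST LABEL: semi-synthetic model (not the tempered `π₁` of a curve) — consistency evidence only; classical topological
group theory; nothing of [EtTh]/[SemiAnbd] asserted; no side taken on [IUTchIII] Cor. 3.12.
-/

noncomputable section

namespace Literature.AnabelianGeometry.EtaleTheta.SettingModel

open Literature.AnabelianGeometry.SemiGraphs Literature.AlgebraicGeometry.Frobenioids _root_.Topology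

variable (p : ℕ) [Fact p.Prime] (i j : ℤ)

/-! ### Galois-countability, slimness, temperedness of `Δ` -/

/-- **`Π^tp_X := Γ ⋊_{actχq} G_{ℚ_p}` is Galois-countable** (topology induced along `(left, right)` into `Γ × G_{ℚ_p}`, both
second countable). [cite: MochizukiSemiAnbd2006, Ex 3.10 p.43] -/
theorem secondCountableTopology_PiTpχq : SecondCountableTopology (PiTpχq p i j) := by
  haveI : SecondCountableTopology Gfp := secondCountableTopology_gfp
  haveI : SecondCountableTopology (GQp p) := secondCountableTopology_GQp p
  haveI : SecondCountableTopology (Gfp × GQp p) := inferInstance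
  exact (isInducing_leftRightχq p i j).secondCountableTopology

/-- **`Π^tp_X` of the stage-2 model is slim**: abc-iut-w5-d249's action-generic `Semidirect.isSlimGroup_of` at this seat's
`isSlimGroup_gfp` (Γ slim) and abc-iut-L4's `IsSubpadicFor.isSlimGroup_absoluteGaloisGroup` (`G_{ℚ_p}` slim).
[cite: MochizukiSemiAnbd2006, Ex 3.10 p.45] -/
theorem isSlimGroup_PiTpχq : IsSlimGroup (PiTpχq p i j) :=
  Semidirect.isSlimGroup_of (isInducing_leftRightχq p i j) isSlimGroup_gfp
    (Literature.AnabelianGeometry.AbsoluteAnabelian.IsSubpadicFor.isSlimGroup_absoluteGaloisGroup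
      (Literature.AnabelianGeometry.AbsoluteAnabelian.AbsTopIII.IsSubpadicFor.padic p))

/-- **`Δ^tp_X` of the stage-2 model is slim**: `Δ^tp_X = {g | g.right = 1} = inl(Γ) ≃ₜ* Γ`.
[cite: MochizukiSemiAnbd2006, Ex 3.10 p.45] -/
theorem isSlimGroup_deltaTempχq : IsSlimGroup (curveχq p i j).DeltaTemp := by
  let e : Gfp ≃ₜ* (curveχq p i j).DeltaTemp :=
    { toFun := fun γ => ⟨SemidirectProduct.inl γ, inl_mem_deltaTempχq p i j γ⟩
      invFun := fun g => g.1.left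
      left_inv := fun γ => rfl
      right_inv := fun g => by
        apply Subtype.ext
        change SemidirectProduct.inl g.1.left = g.1
        have hg : g.1.right = 1 := (mem_deltaTempχq_iff p i j g.1).mp g.2
        rw [← SemidirectProduct.inl_left_mul_inr_right g.1, hg, map_one, mul_one]
        rfl
      map_mul' := fun a b => Subtype.ext (map_mul _ a b)
      continuous_toFun := (continuous_inlχq p i j).subtype_mk _
      continuous_invFun :=
        (Semidirect.continuous_left (isInducing_leftRightχq p i j)).comp continuous_subtype_val }
  exact IsSlimGroup.of_continuousMulEquiv' e isSlimGroup_gfp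

/-- **`Δ^tp_X` of the stage-2 model is tempered** («`Δ` is also tempered», Ex. 3.10 p. 43): a closed subgroup of the
tempered `Π^tp_X` (this seat's `TemperedCurve.isTempered_deltaTemp_of_isTempered`, p417615).
[cite: MochizukiSemiAnbd2006, Ex 3.10 p.43] -/
theorem isTempered_deltaTemp_curveχq : IsTempered (curveχq p i j).DeltaTemp :=
  TemperedCurve.isTempered_deltaTemp_of_isTempered (curveχq p i j) (isTempered_piTemp_curveχq p i j)

/-! ### The bundle -/

/-- **The group-level datum of the stage-2 model, UNCONDITIONALLY**: abc-iut-L3's parameter bundle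
`TemperedCurve.GroupLevelData (curveχq p i j)` («`Π`, `Δ` tempered», «`Π`, `Δ` temp-slim», «`Π` Galois-countable»,
`G_K ≃ Gal(K̄/K)`) is inhabited for every `(i, j)`. [cite: MochizukiSemiAnbd2006, Ex 3.10 p.45] -/
theorem nonempty_groupLevelData_curveχq_holds : Nonempty (TemperedCurve.GroupLevelData (curveχq p i j)) := by
  have hker : ((curveχq p i j).augK (curveχq p i j).galoisIdentification).toMonoidHom.ker =
      (curveχq p i j).DeltaTemp := (curveχq p i j).ker_augK _
  refine ⟨{ galEquiv := (curveχq p i j).galoisIdentification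
            isTempered := isTempered_piTemp_curveχq p i j
            isTempered_ker := by rw [hker]; exact isTempered_deltaTemp_curveχq p i j
            isSlimGroup := isSlimGroup_PiTpχq p i j
            isSlimGroup_ker := by rw [hker]; exact isSlimGroup_deltaTempχq p i j
            secondCountableTopology := secondCountableTopology_PiTpχq p i j }⟩

/-- The bridge of abc-iut-L3-lead's ruling η fires at the stage-2 model: a `TemperedArithmeticGroup ℚ_p`-datum with
`Π := Γ ⋊_{actχq} G_{ℚ_p}`. [cite: MochizukiSemiAnbd2006, Ex 3.10 p.43] -/
theorem exists_toTemperedArithmeticGroup_curveχq_holds :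
    ∃ d : TemperedCurve.GroupLevelData (curveχq p i j),
      ((curveχq p i j).toTemperedArithmeticGroup d).Pi = PiTpχq p i j :=
  ⟨(nonempty_groupLevelData_curveχq_holds p i j).some, rfl⟩

/-! ### η′-consequences at the stage-2 model -/

/-- The augmentation of `curveχq` is an open map — open-mapping-theorem route through the bundle (agrees with
abc-iut-w5-d249's direct `isOpenMap_augχq`). [cite: MochizukiSemiAnbd2006, §6 p.69] -/
theorem isOpenMap_aug_curveχq' : IsOpenMap (curveχq p i j).aug :=
  (curveχq p i j).isOpenMap_aug_of_groupLevelData (nonempty_groupLevelData_curveχq_holds p i j).some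

/-- **Exactness of `1 → Δ_X → Π_X → G_K` at the stage-2 model**: `Ker(augHat) = Δ_X` — field (P1) of
`ThetaSetting.OncePuncturedData` (abc-iut-w5-d139's `TemperedCurve.ker_augHat_eq_deltaHat` at the bundle).
[cite: MochizukiSemiAnbd2006, §6 p.69] -/
theorem ker_augHat_eq_deltaHat_curveχq :
    (curveχq p i j).augHat.toMonoidHom.ker = (curveχq p i j).DeltaHat :=
  (curveχq p i j).ker_augHat_eq_deltaHat (nonempty_groupLevelData_curveχq_holds p i j).some

/-- **`Δ_X` is the profinite completion of `Δ^tp_X` at the stage-2 model** ([SemiAnbd] §6 p. 73).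
[cite: MochizukiSemiAnbd2006, §6 p.73] -/
theorem isProfiniteCompletion_deltaToHat_curveχq : IsProfiniteCompletion (curveχq p i j).deltaToHat :=
  (curveχq p i j).isProfiniteCompletion_deltaToHat (nonempty_groupLevelData_curveχq_holds p i j).some

end Literature.AnabelianGeometry.EtaleTheta.SettingModel

end
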